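import Summits.QuantumFields.YangMills.Theorems.FluctuationComparisonRegPrIntLHeightwiseQuotientAnchoring
import Summits.QuantumFields.YangMills.Theorems.FluctuationComparisonRegPrIntLHeightwiseMainTermOfMembership
import Literature.MathematicalPhysics.QuantumFieldTheory.Balaban1983to89.T3ThresholdSmallness
import HarnessLib

/-!
# UP∘-QUOT (B) — THE PERSISTENCE ORGAN's ROWS UP∘ (lit `HeightwiseUpperBound F γ`) AND LOWB∘ FOR THE PINNED `ℰp` DENSITIES FROM THE v3 (α) PACKAGE, WITH ONE DISPLAYED ROW
# (the heightwise trivial-history main term): NO counterterm row (62)–(65), NO displayed large-field row, NO Haar compatibility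

Cell `ym3-torus` (YM ladder rung R3 = continuum `SU(2)` Yang–Mills on the three-torus — a RUNG, NOT d = 4, NOT infinite volume, NOT a mass gap, NOT Clay).  Width seat
`ym-ust-20520-w3` (gen 19, LEAD-20520 by lineage); `--supports stmt-QuantumFields-20520 --as helper`, count-neutral, definition-free, default heartbeats.  Companion of (A)
`…HeightwiseQuotientAnchoring` (same-level anchoring over `AlphaInputsT3AC.PkgAtV3`).  TARGET ROWS (VERBATIM): UP∘ `StabilityUpperCan` and LOWB∘ `StabilityLowerWindowCan` of
`Cruxes/FluctuationComparisonRegPrIntL/Lines/history_split.lean` (ideator LINE g23-1∕2∕3) — the persistence leaf PERS₁∘∕TUBE∘ of S2β's LFR♯ᶜ∘ reads them (★★OWNER 2026-08-30 08:05:20Z).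

WHAT.  At height `n`, every input of (A)'s `ae_quotient_bounds_level` is `K`-FREE and — but one — a THEOREM of the tree over the v3 record `h.pkgAtV3 hc γ hγ hγ1 K`
(`h : AlphaInputsT3AC.OfV3At F 𝔠 a₀ a₁`, R3's record socket, ★★OWNER RULING g18-№3): (46) `CP_n = (C46M₁³)·θBal(n+1)²·((F.P n).sitesPerDir 0)³`; `exp(Rm) ≤ CRm`
(✓`dataT3v3_rmSize`); THE (41) LARGE-FIELD HISTORY SUM BOUND AT EVERY LEVEL `B_n = exp(#PBond(F.P n,0)·A + (6∕log L)·#Site(F.P n,0))` a.e. — ym3-torus-px8 g15's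
✓`UV3ACLargeFieldEnvelopeAtLevel.exists_lfSum_le_exp_ae` (B25 from the v3 package ALONE via the hTop mass envelope), read at level `K − n` through `card_level_eq`; the window volume;
and the ONE displayed row `hMainH` — the trivial-history main term `mainT_{K−n}(triv, W) = β_K·A(U_{K−n}(triv, W)) ≤ Cm_n` on `{PlaqSmall θBal(𝔠.b₀, 𝔠.p₀, n)}` for `K > n`
([Balaban1985Variational] Thm 1 regularity; the package DELIVERS the membership ✓`PkgAtV3.uminTriv_mem_regFibrePr`, the regular-fibre action arithmetic at height `n` is seat
w4-20520's ⟨MAIN-H⟩; the run `K = n` is settled HERE by `A ≤ 2·#Plaq`, ✓`PkgAtV3.mainT_eq` + lit `wilsonAction4_le_two_mul_card`).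
* §4 ★ `ae_heightDensity_of_ae_resDensity` — transport to lit `heightDensity` along `fieldShift` (quasi-measure-preserving).
* §5 `card_level_eq`; ★★★★ `quotientBounds_of_packageV3_of_mainH` — `∀ n, ∃ C, ∃ c > 0, ∀ K ≥ n`: a.e. `Z_K⁻¹·heightDensity F γ hK univ ≤ C` and, a.e. on the window,
  `c ≤ Z_K⁻¹·heightDensity F γ hK univ` — MODULO THE v3 PACKAGE AND `hMainH` ONLY.
* §6 ★★★★ `heightwiseUpperBound_of_packageV3_of_mainH : HeightwiseUpperBound F γ` (UP∘'s body per `(F, γ)`); ★★★ `heightwiseLowerWindow_of_packageV3_of_mainH` (LOWB∘'s body at the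
  record profile); ★★★★ `stabilityCans_of_v3Rec_of_mainH` — UP∘ ∧ LOWB∘ TEXTS VERBATIM from the GUARDED record socket `∀ L, Odd L → 1 < L → AlphaInputsT3ACv3Rec L` (its prefix
  `∃ b₁ p₁ ∀ b₀ ≥ b₁ ∀ p₀ ≥ p₁ ∃ 𝔠, 𝔠.b₀ = b₀ ∧ 𝔠.p₀ = p₀` IS LOWB∘'s `∃ bB pB ∀ b₀ p₀`) and the main-term row below a threshold `γM L 𝔠 a₀ a₁` fixed before the family.

NET FOR THE CENSUS.  UP∘ and LOWB∘ ⟸ {v3 record socket, heightwise main-term row} — the persistence leaf's «Thm 1 (5)∕(6) K-uniform» is, after px8's B25-at-every-level and this knit,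
the UV3 node's socket of record plus ONE [Balaban1985Variational] row the package itself nearly closes; no separate XL leaf.

HYP-SAT (★★OWNER №32∕№38∕№42).  Socket guarded (class (1)); all letters `dV`-a.e.; `hMainH` in the package's own letters (`T.mainT`, `T.triv`), with its coupling threshold as an
explicit function `γM` (the smallness `θBal(n) ≤ a₁`, `B₃θBal(n) ≤ a₀`, lit ✓`exists_forall_θBal_le`).  PROFILE: lower window at the RECORD profile; the record socket ranges over all
profiles beyond `(b₁, p₁)` = LOWB∘'s shape.

HONEST SCOPE.  Bookkeeping over landed rows; CONDITIONAL on the OPEN v3 (α) package and on `hMainH`; Theorem 1 NOT proved; UP∘∕LOWB∘∕PERS₁∘∕TUBE∘∕LFR♯ᶜ∘∕S2β∕20520 NOT proved; no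
summit is proved by a helper; rung R3 = SU(2) YM₃ on T³ — NOT d = 4, NOT infinite volume, NOT a mass gap, NOT Clay.  Sorry-free, axioms standard.

References: T. Bałaban, CMP **102** (1985) 255–275 [Balaban1985UV3] ((1)–(7) pp.256–257, Thm 1 p.257, (41) p.266, (46)–(47) p.267, (64)–(65) p.273, pp.273–274); T. Bałaban,
CMP **102** (1985) 277–309 [Balaban1985Variational] (Thm 1 p.279); T. Bałaban, CMP **109** (1987) 249–301 [Balaban1987RG1] ((0.1)–(0.4) pp.251–253).
-/

set_option autoImplicit false

noncomputable section

namespace Summit.QuantumFields.YangMills.Theorems.FluctuationComparisonRegPrIntLHeightwiseQuotientOfPackageV3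

open MeasureTheory
open scoped BigOperators
open Literature.MathematicalPhysics.QuantumFieldTheory.Balaban1983to89
open Literature.MathematicalPhysics.QuantumFieldTheory.Balaban1983to89.T3ContinuumYM3Torus
open Literature.MathematicalPhysics.QuantumFieldTheory.Balaban1983to89.T3UnitLawDensityEML (ℰp emlDensity)
open Literature.MathematicalPhysics.QuantumFieldTheory.Balaban1983to89.T3UnitScaleTilt (θBal measurableSet_plaqSmall)
open Literature.MathematicalPhysics.QuantumFieldTheory.Balaban1983to89.T3RestrictedUnitDensity (resDensity resDensity_nonneg integrable_resDensity)
open Literature.MathematicalPhysics.QuantumFieldTheory.Balaban1983to89.T3TiltDescent (heightDensity)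
open Literature.MathematicalPhysics.QuantumFieldTheory.Balaban1983to89.T3HeightwiseDensityBounds
open Literature.MathematicalPhysics.QuantumFieldTheory.Balaban1983to89.T3AlphaInputsAC (RmSize exp_two_Rm_le Rm_nonneg)
open Literature.MathematicalPhysics.QuantumFieldTheory.Balaban1983to89.T3LevelShift (fieldShift measurePreserving_fieldShift)
open Literature.MathematicalPhysics.QuantumFieldTheory.Balaban1983to89.Missing (partitionFn partitionFn_pos' isProbabilityMeasure_fieldMeasure)
open Literature.MathematicalPhysics.QuantumFieldTheory.Balaban1985CMP102
open Literature.MathematicalPhysics.QuantumFieldTheory.Balaban1985CMP102.Setting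
open Summit.QuantumFields.Balaban3D.Carriers
open Summit.QuantumFields.Balaban3D.Proofs.Primitives
open Summit.QuantumFields.Balaban3D.Proofs.InputsAC
open Summit.QuantumFields.YangMills.Theorems.FluctuationComparisonRegPrIntLHeightwiseQuotientAnchoring

/-! ## §4 Transport to the `n`-th tower's finest lattice (`heightDensity` reads `resDensity` through `fieldShift`) -/

section Transport

variable (F : T3Family) (γ : ℝ) {n K : ℕ} (hK : n ≤ K)

/-- ★ **A `dV_{K−n}`-A.E. PROPERTY OF `ρ^{univ}_{K−n}` IS A `dU^{(n)}`-A.E. PROPERTY OF `heightDensity`** (lit `T3TiltDescent.heightDensity` is `resDensity ∘ fieldShift`,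
definitional; `fieldShift` is measure-preserving, lit `T3LevelShift.measurePreserving_fieldShift`). [cite: Balaban1985UV3, (2) p.256] -/
theorem ae_heightDensity_of_ae_resDensity {Q : GaugeField (F.P K) (K - n) (Matrix.specialUnitaryGroup (Fin 2) ℂ) → ℝ → Prop}
    (h : ∀ᵐ W ∂fieldMeasure (F.P K) (K - n) (Matrix.specialUnitaryGroup (Fin 2) ℂ), Q W (resDensity F γ K Set.univ (K - n) W)) :
    ∀ᵐ V ∂fieldMeasure (F.P n) 0 (Matrix.specialUnitaryGroup (Fin 2) ℂ),
      Q (fieldShift (F.sitesPerDir_eq (m := F.m) (K := K) (j := K - n) (m' := F.m) (K' := n) (j' := 0) (by omega)) V)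
        (heightDensity F γ hK Set.univ V) :=
  (measurePreserving_fieldShift (G := Matrix.specialUnitaryGroup (Fin 2) ℂ) (F := F)
      (F.sitesPerDir_eq (m := F.m) (K := K) (j := K - n) (m' := F.m) (K' := n) (j' := 0) (by omega))).quasiMeasurePreserving.ae h

end Transport

/-! ## §5 UP∘ and the windowed lower quotient at the record profile, MODULO THE v3 PACKAGE AND THE HEIGHTWISE MAIN-TERM ROW ONLY -/

section Package

variable {F : T3Family} {𝔠 : AlphaConsts F.L (suGroupModel 2).N} {a₀ a₁ : ℝ}
  (h : AlphaInputsT3AC.OfV3At F 𝔠 a₀ a₁) (hc : 0 < a₀ ∧ 0 < a₁ ∧ 𝔠.B₃ * a₁ ≤ a₀) (γ : ℝ) (hγ : 0 < γ) (hγ1 : γ ≤ (min 𝔠.gamma0 1) ^ 2)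

/-- **THE LEVEL COUNTS AT HEIGHT `n` ARE `K`-FREE**: `#PBond(F.P K, K − n) = #PBond(F.P n, 0)` and `#Site(F.P K, K − n) = #Site(F.P n, 0)` (lit `T3LevelShift.bondShift`∕`siteShift`).
[cite: Balaban1987RG1, (0.1) p.251] -/
theorem card_level_eq (F : T3Family) {n K : ℕ} (hK : n ≤ K) :
    Fintype.card (PBond (F.P K) (K - n)) = Fintype.card (PBond (F.P n) 0) ∧
      Fintype.card (Site (F.P K) (K - n)) = Fintype.card (Site (F.P n) 0) :=
  ⟨Fintype.card_congr (T3LevelShift.bondShift (F := F)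
      (F.sitesPerDir_eq (m := F.m) (K := K) (j := K - n) (m' := F.m) (K' := n) (j' := 0) (by omega))),
    Fintype.card_congr (T3LevelShift.siteShift (F := F)
      (F.sitesPerDir_eq (m := F.m) (K := K) (j := K - n) (m' := F.m) (K' := n) (j' := 0) (by omega)))⟩

/-- ★★★★ **THE TWO-SIDED HEIGHTWISE QUOTIENT BOUNDS FOR THE PINNED `ℰp` DENSITIES MODULO THE v3 (α) PACKAGE AND ONE ROW.**  Under `AlphaInputsT3AC.OfV3At F 𝔠 a₀ a₁`
(the record socket of R3, v3 edition) at `γ ∈ (0, (min γ₀ 1)²]`, IF the trivial-history main term of the package's tower is bounded at every height on print's window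
(`hMainH`: `∀ n, ∃ Cm, ∀ K > n, ∀ W ∈ {PlaqSmall θBal(𝔠.b₀, 𝔠.p₀, n)} ⊂ T₁^{(K−n)}, mainT_{K−n}(triv, W) ≤ Cm` — [Balaban1985Variational] Thm 1 regularity; the package's r1
membership ✓`PkgAtV3.uminTriv_mem_regFibrePr` + the regular-fibre action arithmetic, seat w4-20520), THEN for every height `n` there are `C_n, c_n > 0` with, for all `K ≥ n`,
a.e. `Z_K⁻¹·heightDensity F γ hK univ ≤ C_n` and, a.e. on `{PlaqSmall θBal(n)}`, `c_n ≤ Z_K⁻¹·heightDensity F γ hK univ` — from §3 with EVERY other row a theorem of the tree: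
(41)P a.e. ✓`PkgAtV3.resDensity_le_sum_ae`, B25 at every level ✓`UV3ACLargeFieldEnvelopeAtLevel.exists_lfSum_le_exp_ae` (ym3-torus-px8 g15), (46) ✓`PkgAtV3.abs_Pint_succ_le`,
the remainder ✓`dataT3v3_rmSize`, (47) a.e. ✓`PkgAtV3.le_resDensity_ae`, `χ = 1` on the window, the `K`-free window volume; the run `K = n` (level `0`, `U₀(triv, W) = W`) by the
a-priori bound `A ≤ 2·#Plaq`.  NO counterterm size (62)–(65), NO large-field row, NO Haar compatibility. [cite: Balaban1985UV3, (5)–(6) pp.256–257, (41) p.266, (46)–(47) p.267, pp.273–274; Balaban1985Variational, Thm 1 p.279] -/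
theorem quotientBounds_of_packageV3_of_mainH
    (hMainH : ∀ n : ℕ, ∃ Cm : ℝ, ∀ (K : ℕ) (hK : n < K) (W : GaugeField (F.P K) (K - n) (Matrix.specialUnitaryGroup (Fin 2) ℂ)),
      PlaqSmall (θBal F.L γ 𝔠.b₀ 𝔠.p₀ n) W →
        (h.pkgAtV3 hc γ hγ hγ1 K).T.mainT (K - n) ((h.pkgAtV3 hc γ hγ hγ1 K).T.triv (K - n)) W ≤ Cm) (n : ℕ) :
    ∃ C c : ℝ, 0 < c ∧ ∀ (K : ℕ) (hK : n ≤ K),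
      (∀ᵐ V ∂fieldMeasure (F.P n) 0 (Matrix.specialUnitaryGroup (Fin 2) ℂ),
        (partitionFn (G := Matrix.specialUnitaryGroup (Fin 2) ℂ) (F.P K) ((F.scheme ℰp γ).β K))⁻¹ * heightDensity F γ hK Set.univ V ≤ C) ∧
      (∀ᵐ V ∂fieldMeasure (F.P n) 0 (Matrix.specialUnitaryGroup (Fin 2) ℂ), PlaqSmall (θBal F.L γ 𝔠.b₀ 𝔠.p₀ n) V →
        c ≤ (partitionFn (G := Matrix.specialUnitaryGroup (Fin 2) ℂ) (F.P K) ((F.scheme ℰp γ).β K))⁻¹ * heightDensity F γ hK Set.univ V) := by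
  -- the K-free constants at height `n`
  obtain ⟨A, hA0, hA⟩ := UV3ACLargeFieldEnvelopeAtLevel.exists_lfSum_le_exp_ae F
  -- the interface's polymer parameter is not read by the rows used here; any value serves
  let π : AlphaInputsT3AC.PolymerT3 F :=
    { Loc := fun _ _ _ _ => ∅, Pterm := fun _ _ _ _ => 0, enl := fun _ _ X => X, treeLen := fun _ _ _ => 0 }
  obtain ⟨CRm, hCRm⟩ := exp_two_Rm_le (h.dataT3v3_rmSize hc γ hγ hγ1 π)
  obtain ⟨Cm, hCm⟩ := hMainH n
  set CP : ℝ := (𝔠.C46 * (𝔠.M₁ : ℝ) ^ 3) * θBal F.L γ 𝔠.b₀ 𝔠.p₀ (n + 1) ^ 2 * (((F.P n).sitesPerDir 0 : ℕ) : ℝ) ^ 3 with hCPdef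
  set B : ℝ := Real.exp ((Fintype.card (PBond (F.P n) 0) : ℝ) * A + 3 / (Real.log F.L / 2) * (Fintype.card (Site (F.P n) 0) : ℝ)) with hBdef
  set M : ℝ := max Cm ((F.scheme ℰp γ).β n * (2 * Fintype.card (Plaq (F.P n) 0))) with hMdef
  set vol : ℝ := (fieldMeasure (F.P n) 0 (Matrix.specialUnitaryGroup (Fin 2) ℂ)).real
    {V : GaugeField (F.P n) 0 (Matrix.specialUnitaryGroup (Fin 2) ℂ) | PlaqSmall (θBal F.L γ 𝔠.b₀ 𝔠.p₀ n) V} with hvoldef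
  have hCRm0 : 0 < CRm := (Real.exp_pos _).trans_le (hCRm 0 0 le_rfl)
  have hB0 : 0 < B := Real.exp_pos _
  refine ⟨(CRm * Real.exp CP * B) / ((CRm⁻¹ * Real.exp (-M - CP)) * vol), (CRm⁻¹ * Real.exp (-M - CP)) / (CRm * Real.exp CP * B),
    by positivity, fun K hK => ?_⟩
  set p := h.pkgAtV3 hc γ hγ hγ1 K with hpdef
  -- the rows at level `K − n`
  have hP : ∀ (r : Hist (F.P K) (K - n)) (W : GaugeField (F.P K) (K - n) (Matrix.specialUnitaryGroup (Fin 2) ℂ)), |p.T.Pint (K - n) r W| ≤ CP := by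
    intro r W
    have h1 := UV3ACBounds5UpperRows.abs_Pint_le_level p (K - n) (Nat.sub_le K n) r W
    have hKn : K - (K - n) + 1 = n + 1 := by omega
    have hsd : (((F.P K).sitesPerDir (K - n) : ℕ) : ℝ) = (((F.P n).sitesPerDir 0 : ℕ) : ℝ) := by
      exact_mod_cast F.sitesPerDir_eq (m := F.m) (K := K) (j := K - n) (m' := F.m) (K' := n) (j' := 0) (by omega)
    rw [hKn, hsd] at h1
    exact h1
  have hRm : Real.exp (p.T.Rm (K - n)) ≤ CRm := by
    have h2 : Real.exp (2 * p.T.Rm (K - n)) ≤ CRm := hCRm K (K - n) (Nat.sub_le K n)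
    have h0 : 0 ≤ p.T.Rm (K - n) := Rm_nonneg (h.dataT3v3_rmSize hc γ hγ hγ1 π) (K := K) (j := K - n) (Nat.sub_le K n)
    exact le_trans (Real.exp_le_exp.mpr (by linarith)) h2
  have hBae : ∀ᵐ W ∂fieldMeasure (F.P K) (K - n) (Matrix.specialUnitaryGroup (Fin 2) ℂ),
      ∑ r : Hist (F.P K) (K - n), p.wtP (K - n) r W * Real.exp (-(p.T.mainT (K - n) r W) + p.T.Zterm (K - n) r) ≤ B := by
    have h3 := hA 𝔠 γ hγ hγ1 K p (K - n) (Nat.sub_le K n)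
    obtain ⟨hb, hs⟩ := card_level_eq F hK
    rw [hb, hs] at h3
    exact h3
  have hM : ∀ (W : GaugeField (F.P K) (K - n) (Matrix.specialUnitaryGroup (Fin 2) ℂ)), PlaqSmall (θBal F.L γ 𝔠.b₀ 𝔠.p₀ n) W →
      p.T.mainT (K - n) (p.T.triv (K - n)) W ≤ M := by
    intro W hW
    rcases Nat.lt_or_ge n K with hlt | hge
    · exact (hCm K hlt W hW).trans (le_max_left _ _)
    · -- the run `K = n`: the a-priori bound `β_K·A(U_{K−K}(triv, W)) ≤ β_K·2·#Plaq(T_η)` (✓`PkgAtV3.mainT_eq`, lit `wilsonAction4_le_two_mul_card`)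
      have hKn : K = n := le_antisymm hge hK
      subst hKn
      rw [p.mainT_eq]
      refine le_trans ?_ (le_max_right _ _)
      exact mul_le_mul_of_nonneg_left (T3MinimiserStabilityReduction.wilsonAction4_le_two_mul_card _) (F.scheme_β_nonneg ℰp hγ.le K)
  obtain ⟨hupK, hlowK⟩ := ae_quotient_bounds_level p hK hCRm0 hB0 hP hRm hBae hM
  refine ⟨?_, ?_⟩
  · exact ae_heightDensity_of_ae_resDensity F γ hK
      (Q := fun _ r => (partitionFn (G := Matrix.specialUnitaryGroup (Fin 2) ℂ) (F.P K) ((F.scheme ℰp γ).β K))⁻¹ * r ≤ _) hupK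
  · have ht := ae_heightDensity_of_ae_resDensity F γ hK
      (Q := fun W r => PlaqSmall (θBal F.L γ 𝔠.b₀ 𝔠.p₀ n) W →
        (CRm⁻¹ * Real.exp (-M - CP)) / (CRm * Real.exp CP * B) ≤
          (partitionFn (G := Matrix.specialUnitaryGroup (Fin 2) ℂ) (F.P K) ((F.scheme ℰp γ).β K))⁻¹ * r) hlowK
    filter_upwards [ht] with V hV hsmall
    exact hV ((T3CruxEstimates.plaqSmall_fieldShift F _ (θBal F.L γ 𝔠.b₀ 𝔠.p₀ n) V).2 hsmall)

end Package


/-! ## §6 The tree schema UP∘ per `(F, γ)` and the organ rows UP∘ ∕ LOWB∘ VERBATIM from the RECORD SOCKET `AlphaInputsT3ACv3Rec` and the main-term row -/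

section Organ

variable {F : T3Family} {𝔠 : AlphaConsts F.L (suGroupModel 2).N} {a₀ a₁ : ℝ}

/-- ★★★★ **UP∘ PER `(F, γ)` — lit `HeightwiseUpperBound F γ` MODULO THE v3 PACKAGE AND THE HEIGHTWISE MAIN-TERM ROW** (§5, upper conjunct).
[cite: Balaban1985UV3, (5)–(6) pp.256–257 + Thm 1 p.257] -/
theorem heightwiseUpperBound_of_packageV3_of_mainH (h : AlphaInputsT3AC.OfV3At F 𝔠 a₀ a₁) (hc : 0 < a₀ ∧ 0 < a₁ ∧ 𝔠.B₃ * a₁ ≤ a₀)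
    (γ : ℝ) (hγ : 0 < γ) (hγ1 : γ ≤ (min 𝔠.gamma0 1) ^ 2)
    (hMainH : ∀ n : ℕ, ∃ Cm : ℝ, ∀ (K : ℕ) (hK : n < K) (W : GaugeField (F.P K) (K - n) (Matrix.specialUnitaryGroup (Fin 2) ℂ)),
      PlaqSmall (θBal F.L γ 𝔠.b₀ 𝔠.p₀ n) W →
        (h.pkgAtV3 hc γ hγ hγ1 K).T.mainT (K - n) ((h.pkgAtV3 hc γ hγ hγ1 K).T.triv (K - n)) W ≤ Cm) :
    HeightwiseUpperBound F γ := fun n => by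
  obtain ⟨C, c, -, hCc⟩ := quotientBounds_of_packageV3_of_mainH h hc γ hγ hγ1 hMainH n
  exact ⟨C, fun K hK => (hCc K hK).1⟩

/-- ★★★ **THE WINDOWED LOWER QUOTIENT LETTER AT THE RECORD PROFILE, PER `(F, γ)`** (LOWB∘'s body at `(b₀, p₀) := (𝔠.b₀, 𝔠.p₀)`): `∀ n, ∃ cl > 0, ∀ K ≥ n, ∀ᵐ V,
PlaqSmall θBal(n) V → cl ≤ Z_K⁻¹·heightDensity F γ hK univ V` — §5, lower conjunct. [cite: Balaban1985UV3, (4)–(5) p.256, (7) p.257, (47) p.267] -/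
theorem heightwiseLowerWindow_of_packageV3_of_mainH (h : AlphaInputsT3AC.OfV3At F 𝔠 a₀ a₁) (hc : 0 < a₀ ∧ 0 < a₁ ∧ 𝔠.B₃ * a₁ ≤ a₀)
    (γ : ℝ) (hγ : 0 < γ) (hγ1 : γ ≤ (min 𝔠.gamma0 1) ^ 2)
    (hMainH : ∀ n : ℕ, ∃ Cm : ℝ, ∀ (K : ℕ) (hK : n < K) (W : GaugeField (F.P K) (K - n) (Matrix.specialUnitaryGroup (Fin 2) ℂ)),
      PlaqSmall (θBal F.L γ 𝔠.b₀ 𝔠.p₀ n) W →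
        (h.pkgAtV3 hc γ hγ hγ1 K).T.mainT (K - n) ((h.pkgAtV3 hc γ hγ hγ1 K).T.triv (K - n)) W ≤ Cm) :
    ∀ (n : ℕ), ∃ cl : ℝ, 0 < cl ∧ ∀ (K : ℕ) (hK : n ≤ K),
      ∀ᵐ V ∂(fieldMeasure (F.P n) 0 (Matrix.specialUnitaryGroup (Fin 2) ℂ)),
        PlaqSmall (θBal F.L γ 𝔠.b₀ 𝔠.p₀ n) V →
          cl ≤ (partitionFn (G := Matrix.specialUnitaryGroup (Fin 2) ℂ) (F.P K) ((F.scheme ℰp γ).β K))⁻¹ *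
            heightDensity F γ hK Set.univ V := fun n => by
  obtain ⟨C, c, hc0, hCc⟩ := quotientBounds_of_packageV3_of_mainH h hc γ hγ hγ1 hMainH n
  exact ⟨c, hc0, fun K hK => (hCc K hK).2⟩

/-- ★★★★ **THE ORGAN ROWS UP∘ AND LOWB∘ — `StabilityUpperCan` ∧ `StabilityLowerWindowCan` of `Cruxes/…/Lines/history_split.lean` (ideator LINE g23-1∕g23-2∕g23-3), TEXTS VERBATIM —
FROM TWO NAMED ROWS OVER THE FAMILIES**: the GUARDED record socket of R3 `∀ L, Odd L → 1 < L → AlphaInputsT3ACv3Rec L` (★★OWNER RULINGS g18-№3 ∕ №38; its prefix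
`∃ b₁ p₁ ∀ b₀ ≥ b₁ ∀ p₀ ≥ p₁ ∃ 𝔠, 𝔠.b₀ = b₀ ∧ 𝔠.p₀ = p₀ …` IS LOWB∘'s `∃ bB pB ∀ b₀ p₀ …`) and the heightwise main-term row for every package datum below a coupling threshold
`γM L 𝔠 a₀ a₁` fixed BEFORE the family ([Balaban1985Variational] Thm 1 via the package's r1 membership + smallness of `θBal(n)` against `a₀, a₁`; seat w4-20520);
`γ₁ := min (min γ₀ 1)² (γM L 𝔠 a₀ a₁)`.  A FACE: conclusions = the rows' texts, hypotheses = named rows; B25, (46), (62)–(65), `Rm`, (41), (47) are NOT displayed — they are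
theorems of the tree over the package (ym3-torus-px8 ✓`UV3ACLargeFieldEnvelopeAtLevel`, the v3 API).  The `L` with no three-torus family (`¬(Odd L ∧ 1 < L)`) are vacuous.
[cite: Balaban1985UV3, Thm 1 (5) pp.256–257, (41) p.266, (46)–(47) p.267, pp.273–274; Balaban1985Variational, Thm 1 p.279] -/
theorem stabilityCans_of_v3Rec_of_mainH
    (hrec : ∀ L : ℕ, Odd L → 1 < L → AlphaInputsT3ACv3Rec L)
    (γM : (L : ℕ) → AlphaConsts L (suGroupModel 2).N → ℝ → ℝ → ℝ)
    (hγM : ∀ (L : ℕ) (𝔠 : AlphaConsts L (suGroupModel 2).N) (a₀ a₁ : ℝ), 0 < γM L 𝔠 a₀ a₁)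
    (hMainH : ∀ (F : T3Family) (𝔠 : AlphaConsts F.L (suGroupModel 2).N) (a₀ a₁ : ℝ) (h : AlphaInputsT3AC.OfV3At F 𝔠 a₀ a₁)
      (hc : 0 < a₀ ∧ 0 < a₁ ∧ 𝔠.B₃ * a₁ ≤ a₀) (γ : ℝ) (hγ : 0 < γ) (hγ1 : γ ≤ (min 𝔠.gamma0 1) ^ 2), γ ≤ γM F.L 𝔠 a₀ a₁ →
      ∀ n : ℕ, ∃ Cm : ℝ, ∀ (K : ℕ) (hK : n < K) (W : GaugeField (F.P K) (K - n) (Matrix.specialUnitaryGroup (Fin 2) ℂ)),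
        PlaqSmall (θBal F.L γ 𝔠.b₀ 𝔠.p₀ n) W →
          (h.pkgAtV3 hc γ hγ hγ1 K).T.mainT (K - n) ((h.pkgAtV3 hc γ hγ hγ1 K).T.triv (K - n)) W ≤ Cm) :
    (∀ (L : ℕ), ∃ γ₁ : ℝ, 0 < γ₁ ∧ ∀ (F : T3Family) (γ : ℝ), F.L = L → 0 < γ → γ ≤ γ₁ → HeightwiseUpperBound F γ) ∧
    (∀ (L : ℕ), ∃ bB pB : ℝ, ∀ (b₀ p₀ : ℝ), bB ≤ b₀ → pB ≤ p₀ →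
      ∃ γ₁ : ℝ, 0 < γ₁ ∧ ∀ (F : T3Family) (γ : ℝ), F.L = L → 0 < γ → γ ≤ γ₁ →
        ∀ (n : ℕ), ∃ cl : ℝ, 0 < cl ∧ ∀ (K : ℕ) (hK : n ≤ K),
          ∀ᵐ V ∂(fieldMeasure (F.P n) 0 (Matrix.specialUnitaryGroup (Fin 2) ℂ)),
            PlaqSmall (θBal F.L γ b₀ p₀ n) V →
              cl ≤ (partitionFn (G := Matrix.specialUnitaryGroup (Fin 2) ℂ) (F.P K) ((F.scheme ℰp γ).β K))⁻¹ *
                heightDensity F γ hK Set.univ V) := by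
  -- both rows from ONE per-profile statement at block size `L`
  have key : ∀ (L : ℕ), Odd L → 1 < L → ∃ bB pB : ℝ, ∀ (b₀ p₀ : ℝ), bB ≤ b₀ → pB ≤ p₀ →
      ∃ γ₁ : ℝ, 0 < γ₁ ∧ ∀ (F : T3Family) (γ : ℝ), F.L = L → 0 < γ → γ ≤ γ₁ →
        HeightwiseUpperBound F γ ∧
        ∀ (n : ℕ), ∃ cl : ℝ, 0 < cl ∧ ∀ (K : ℕ) (hK : n ≤ K),
          ∀ᵐ V ∂(fieldMeasure (F.P n) 0 (Matrix.specialUnitaryGroup (Fin 2) ℂ)),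
            PlaqSmall (θBal F.L γ b₀ p₀ n) V →
              cl ≤ (partitionFn (G := Matrix.specialUnitaryGroup (Fin 2) ℂ) (F.P K) ((F.scheme ℰp γ).β K))⁻¹ *
                heightDensity F γ hK Set.univ V := by
    intro L hodd hL
    obtain ⟨b₁, p₁, hbp⟩ := hrec L hodd hL
    refine ⟨b₁, p₁, fun b₀ p₀ hb hp => ?_⟩
    obtain ⟨𝔠, a₀, a₁, hb₀, hp₀, ha₀, ha₁, hB₃, hOf⟩ := hbp b₀ p₀ hb hp
    refine ⟨min ((min 𝔠.gamma0 1) ^ 2) (γM L 𝔠 a₀ a₁),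
      lt_min (pow_pos (lt_min 𝔠.gamma0_pos one_pos) 2) (hγM L 𝔠 a₀ a₁), fun F γ hFL hγ hγle => ?_⟩
    subst hFL
    subst hb₀
    subst hp₀
    have hγ1 : γ ≤ (min 𝔠.gamma0 1) ^ 2 := hγle.trans (min_le_left _ _)
    have hγ2 : γ ≤ γM F.L 𝔠 a₀ a₁ := hγle.trans (min_le_right _ _)
    have hM := hMainH F 𝔠 a₀ a₁ (hOf F rfl) ⟨ha₀, ha₁, hB₃⟩ γ hγ hγ1 hγ2
    exact ⟨heightwiseUpperBound_of_packageV3_of_mainH (hOf F rfl) ⟨ha₀, ha₁, hB₃⟩ γ hγ hγ1 hM,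
      heightwiseLowerWindow_of_packageV3_of_mainH (hOf F rfl) ⟨ha₀, ha₁, hB₃⟩ γ hγ hγ1 hM⟩
  refine ⟨fun L => ?_, fun L => ?_⟩
  · by_cases hL : Odd L ∧ 1 < L
    · obtain ⟨bB, pB, hkey⟩ := key L hL.1 hL.2
      obtain ⟨γ₁, hγ₁, hF⟩ := hkey bB pB le_rfl le_rfl
      exact ⟨γ₁, hγ₁, fun F γ hFL hγ hγle => (hF F γ hFL hγ hγle).1⟩
    · exact ⟨1, one_pos, fun F γ hFL _ _ => absurd (hFL ▸ F.hL) hL⟩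
  · by_cases hL : Odd L ∧ 1 < L
    · obtain ⟨bB, pB, hkey⟩ := key L hL.1 hL.2
      refine ⟨bB, pB, fun b₀ p₀ hb hp => ?_⟩
      obtain ⟨γ₁, hγ₁, hF⟩ := hkey b₀ p₀ hb hp
      exact ⟨γ₁, hγ₁, fun F γ hFL hγ hγle => (hF F γ hFL hγ hγle).2⟩
    · exact ⟨0, 0, fun b₀ p₀ _ _ => ⟨1, one_pos, fun F γ hFL _ _ => absurd (hFL ▸ F.hL) hL⟩⟩

/-! ## §7 THE ORGAN ROWS FROM THE RECORD SOCKET ALONE — the heightwise main-term row is w4-20520's ✓`hMainH_v3` below the `θBal` smallness threshold -/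

/-- ★★★★ **THE HEIGHTWISE QUOTIENT BOUNDS MODULO THE v3 PACKAGE ALONE, BELOW A SMALLNESS THRESHOLD**: under `h : AlphaInputsT3AC.OfV3At F 𝔠 a₀ a₁`, `hc`, `γ ∈ (0, (min γ₀ 1)²]` AND
`θBal(n) ≤ a₁`, `B₃·θBal(n) ≤ a₀` for all `n` (true for `γ` small, lit ✓`exists_forall_θBal_le`), the conclusion of `quotientBounds_of_packageV3_of_mainH` — its one row discharged BY NAME
by w4-20520's ✓`FluctuationComparisonRegPrIntLHeightwiseMainTermOfMembership.hMainH_v3` (r1 membership ✓`PkgAtV3.uminTriv_mem_regFibrePr` + `β_K·A(U) ≤ 12ε₀²L^{3m+4n}∕γ` on the regular fibre).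
[cite: Balaban1985UV3, (5)–(6) pp.256–257, (41) p.266, (46)–(47) p.267; Balaban1985Variational, Thm 1 (8) p.279] -/
theorem quotientBounds_of_packageV3 (h : AlphaInputsT3AC.OfV3At F 𝔠 a₀ a₁) (hc : 0 < a₀ ∧ 0 < a₁ ∧ 𝔠.B₃ * a₁ ≤ a₀)
    (γ : ℝ) (hγ : 0 < γ) (hγ1 : γ ≤ (min 𝔠.gamma0 1) ^ 2)
    (hθ₁ : ∀ n : ℕ, θBal F.L γ 𝔠.b₀ 𝔠.p₀ n ≤ a₁) (hθ₀ : ∀ n : ℕ, 𝔠.B₃ * θBal F.L γ 𝔠.b₀ 𝔠.p₀ n ≤ a₀) (n : ℕ) :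
    ∃ C c : ℝ, 0 < c ∧ ∀ (K : ℕ) (hK : n ≤ K),
      (∀ᵐ V ∂fieldMeasure (F.P n) 0 (Matrix.specialUnitaryGroup (Fin 2) ℂ),
        (partitionFn (G := Matrix.specialUnitaryGroup (Fin 2) ℂ) (F.P K) ((F.scheme ℰp γ).β K))⁻¹ * heightDensity F γ hK Set.univ V ≤ C) ∧
      (∀ᵐ V ∂fieldMeasure (F.P n) 0 (Matrix.specialUnitaryGroup (Fin 2) ℂ), PlaqSmall (θBal F.L γ 𝔠.b₀ 𝔠.p₀ n) V →
        c ≤ (partitionFn (G := Matrix.specialUnitaryGroup (Fin 2) ℂ) (F.P K) ((F.scheme ℰp γ).β K))⁻¹ * heightDensity F γ hK Set.univ V) :=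
  quotientBounds_of_packageV3_of_mainH h hc γ hγ hγ1
    (fun n => by
      obtain ⟨Cm, hCm⟩ := FluctuationComparisonRegPrIntLHeightwiseMainTermOfMembership.hMainH_v3 h hc γ hγ hγ1 hθ₁ hθ₀ n
      exact ⟨Cm, fun K hK W hW => hCm K hK.le W hW⟩) n

/-- ★★★★★ **THE ORGAN ROWS UP∘ ∧ LOWB∘ (`StabilityUpperCan` ∧ `StabilityLowerWindowCan` of `Lines/history_split.lean`, TEXTS VERBATIM) FROM THE GUARDED RECORD SOCKET OF R3 ALONE**:
`(∀ L, Odd L → 1 < L → AlphaInputsT3ACv3Rec L)` ⟹ UP∘ ∧ LOWB∘.  Per profile `(b₀, p₀)` beyond the socket's thresholds: the record `𝔠` with that profile and its `a₀, a₁`; the coupling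
threshold `γ₁ := min (min γ₀ 1)² γθ` with `γθ` from lit ✓`exists_forall_θBal_le` at `ε := min a₁ (a₀ ∕ B₃)` (so `θBal(n) ≤ a₁` and `B₃θBal(n) ≤ a₀` for every `n`); then
`quotientBounds_of_packageV3`.  NO displayed row beyond the socket: B25 every level = ym3-torus-px8 ✓`exists_lfSum_le_exp_ae`, the main term = w4-20520 ✓`hMainH_v3`, (41)P∕(47)∕(46)∕`Rm`∕`χ`
= the v3 API.  The `L` with no three-torus family are vacuous. [cite: Balaban1985UV3, Thm 1 (5)–(6) pp.256–257, (41) p.266, (46)–(47) p.267, pp.273–274; Balaban1985Variational, Thm 1 p.279] -/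
theorem stabilityCans_of_v3Rec (hrec : ∀ L : ℕ, Odd L → 1 < L → AlphaInputsT3ACv3Rec L) :
    (∀ (L : ℕ), ∃ γ₁ : ℝ, 0 < γ₁ ∧ ∀ (F : T3Family) (γ : ℝ), F.L = L → 0 < γ → γ ≤ γ₁ → HeightwiseUpperBound F γ) ∧
    (∀ (L : ℕ), ∃ bB pB : ℝ, ∀ (b₀ p₀ : ℝ), bB ≤ b₀ → pB ≤ p₀ →
      ∃ γ₁ : ℝ, 0 < γ₁ ∧ ∀ (F : T3Family) (γ : ℝ), F.L = L → 0 < γ → γ ≤ γ₁ →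
        ∀ (n : ℕ), ∃ cl : ℝ, 0 < cl ∧ ∀ (K : ℕ) (hK : n ≤ K),
          ∀ᵐ V ∂(fieldMeasure (F.P n) 0 (Matrix.specialUnitaryGroup (Fin 2) ℂ)),
            PlaqSmall (θBal F.L γ b₀ p₀ n) V →
              cl ≤ (partitionFn (G := Matrix.specialUnitaryGroup (Fin 2) ℂ) (F.P K) ((F.scheme ℰp γ).β K))⁻¹ *
                heightDensity F γ hK Set.univ V) := by
  have key : ∀ (L : ℕ), Odd L → 1 < L → ∃ bB pB : ℝ, ∀ (b₀ p₀ : ℝ), bB ≤ b₀ → pB ≤ p₀ →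
      ∃ γ₁ : ℝ, 0 < γ₁ ∧ ∀ (F : T3Family) (γ : ℝ), F.L = L → 0 < γ → γ ≤ γ₁ →
        HeightwiseUpperBound F γ ∧
        ∀ (n : ℕ), ∃ cl : ℝ, 0 < cl ∧ ∀ (K : ℕ) (hK : n ≤ K),
          ∀ᵐ V ∂(fieldMeasure (F.P n) 0 (Matrix.specialUnitaryGroup (Fin 2) ℂ)),
            PlaqSmall (θBal F.L γ b₀ p₀ n) V →
              cl ≤ (partitionFn (G := Matrix.specialUnitaryGroup (Fin 2) ℂ) (F.P K) ((F.scheme ℰp γ).β K))⁻¹ *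
                heightDensity F γ hK Set.univ V := by
    intro L hodd hL
    obtain ⟨b₁, p₁, hbp⟩ := hrec L hodd hL
    refine ⟨b₁, p₁, fun b₀ p₀ hb hp => ?_⟩
    obtain ⟨𝔠, a₀, a₁, hb₀, hp₀, ha₀, ha₁, hB₃, hOf⟩ := hbp b₀ p₀ hb hp
    -- the smallness threshold: `θBal L γ b₀ p₀ n ≤ min a₁ (a₀ / B₃)` for every `n` once `γ ≤ γθ`
    have hε : 0 < min a₁ (a₀ / 𝔠.B₃) := lt_min ha₁ (div_pos ha₀ 𝔠.B₃_pos)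
    obtain ⟨γθ, hγθ, hθ⟩ := T3ThresholdSmallness.exists_forall_θBal_le hL.le 𝔠.b₀ 𝔠.p₀ hε
    refine ⟨min ((min 𝔠.gamma0 1) ^ 2) γθ, lt_min (pow_pos (lt_min 𝔠.gamma0_pos one_pos) 2) hγθ, fun F γ hFL hγ hγle => ?_⟩
    subst hFL
    subst hb₀
    subst hp₀
    have hγ1 : γ ≤ (min 𝔠.gamma0 1) ^ 2 := hγle.trans (min_le_left _ _)
    have hγ2 : γ ≤ γθ := hγle.trans (min_le_right _ _)
    have hθ₁ : ∀ n : ℕ, θBal F.L γ 𝔠.b₀ 𝔠.p₀ n ≤ a₁ := fun n => (hθ γ hγ hγ2 n).trans (min_le_left _ _)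
    have hθ₀ : ∀ n : ℕ, 𝔠.B₃ * θBal F.L γ 𝔠.b₀ 𝔠.p₀ n ≤ a₀ := fun n => by
      have h1 : θBal F.L γ 𝔠.b₀ 𝔠.p₀ n ≤ a₀ / 𝔠.B₃ := (hθ γ hγ hγ2 n).trans (min_le_right _ _)
      have h2 := mul_le_mul_of_nonneg_left h1 𝔠.B₃_pos.le
      rwa [mul_div_cancel₀ _ 𝔠.B₃_pos.ne'] at h2
    have hq := quotientBounds_of_packageV3 (hOf F rfl) ⟨ha₀, ha₁, hB₃⟩ γ hγ hγ1 hθ₁ hθ₀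
    refine ⟨fun n => ?_, fun n => ?_⟩
    · obtain ⟨C, c, -, hCc⟩ := hq n
      exact ⟨C, fun K hK => (hCc K hK).1⟩
    · obtain ⟨C, c, hc0, hCc⟩ := hq n
      exact ⟨c, hc0, fun K hK => (hCc K hK).2⟩
  refine ⟨fun L => ?_, fun L => ?_⟩
  · by_cases hL : Odd L ∧ 1 < L
    · obtain ⟨bB, pB, hkey⟩ := key L hL.1 hL.2
      obtain ⟨γ₁, hγ₁, hF⟩ := hkey bB pB le_rfl le_rfl
      exact ⟨γ₁, hγ₁, fun F γ hFL hγ hγle => (hF F γ hFL hγ hγle).1⟩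
    · exact ⟨1, one_pos, fun F γ hFL _ _ => absurd (hFL ▸ F.hL) hL⟩
  · by_cases hL : Odd L ∧ 1 < L
    · obtain ⟨bB, pB, hkey⟩ := key L hL.1 hL.2
      refine ⟨bB, pB, fun b₀ p₀ hb hp => ?_⟩
      obtain ⟨γ₁, hγ₁, hF⟩ := hkey b₀ p₀ hb hp
      exact ⟨γ₁, hγ₁, fun F γ hFL hγ hγle => (hF F γ hFL hγ hγle).2⟩
    · exact ⟨0, 0, fun b₀ p₀ _ _ => ⟨1, one_pos, fun F γ hFL _ _ => absurd (hFL ▸ F.hL) hL⟩⟩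


end Organ


end Summit.QuantumFields.YangMills.Theorems.FluctuationComparisonRegPrIntLHeightwiseQuotientOfPackageV3

end
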